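import Mathlib
import Summits.NavierStokesRegularity.NavierStokesRegularity.Theorems.PoloidalWindowDoorPoloidalWindowRigidityZShockTurningShearDefinite

/-!
# Crux K2 `PoloidalWindowRigidity` (stmt-NavierStokesRegularity-19708), line `z_shock` — R3 inhabitant census: QUADRATIC SLICES
# WITH AN ARBITRARY STRUCTURE FUNCTION (VIII) — the ALIGNED parabolic cylinder: a rank-one quadratic slice that is a function of one
# linear coordinate forces, at ONE height, an affine structure function on its value half-line

`--supports stmt-NavierStokesRegularity-19708 --as helper` (leafhand-ns-poloidalwindowdoor-3 g21, cell decomp-ns, 2026-09-01).  Class-free,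
def-free; Mathlib + part III (`…ZShockTurningShearDefinite`, p840033: `eq_affine_of_deriv_eq_Ioi`).  **No stub and no summit is closed
by this file; Navier–Stokes regularity is NOT proved here (rung 0).**

Last case of the single-height analysis of the quadratic slices `W(y) = A + By₀ + Cy₁ + ½(Dy₀² + 2Ey₀y₁ + Gy₁²)` of the autonomous
height-evolution `∂ₛ∂ₛW = γ(W)ΔW + γ'(W)|∇W|²` (parts III–VII: definite; indefinite; saddle; transverse rank one): the ALIGNED rank-one
slice `DG = E²`, `D > 0`, `CD = BE` — then `W = m + (B + Dy₀ + Ey₁)²/(2D)` is a function of the single coordinate `u = Dy₀ + Ey₁`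
(a planar pattern at that height) and `|∇W|² = 2(D+G)(W − m)` identically, so the two-weights argument of parts III/V is void.  What
survives is ONE linear first-order identity along the ray from a bottom point, with the weight `2(D+G)` instead of part III's isotropic
weight `D+G`, and it still integrates:

* `planar_kernel` — `T ≠ 0` and `T·γ(m+τ) + 2T·τ·γ'(m+τ) = l + ρτ` for all `τ ≥ 0` ⇒ `γ(m+τ) = l/T + (ρ/(3T))τ` (`τ ≥ 0`) and
  `γ'(m+τ) = ρ/(3T)` (`τ > 0`): with `δ = γ(m+·) − particular`, `δ + 2τδ' = 0`, so `(τδ²)' = δ(δ + 2τδ') = 0` and `τδ² ≡ 0`.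
* ★ `quadSlice_rank1Aligned_affine` — **single-height rigidity, aligned parabolic cylinder.**  `γ` differentiable; `D > 0`, `DG = E²`,
  `CD = BE`; `ℓ` any quadratic polynomial with `ℓ = γ(W)(D+G) + γ'(W)|∇W|²` on `ℝ²`.  Then with `m = min W`: `W ≥ m`, `W = m` only where
  `|∇W|² = 0`, `γ(m+τ) = γ₀ + 2μ(m+τ)` (`τ ≥ 0`) and `γ'(m+τ) = 2μ` (`τ > 0`) — the same conclusion (and the same shape) as part III's
  `quadSlice_posDef_affine`, so the all-heights gluing of part IV applies to patterns mixing definite and aligned-rank-one heights of one sign.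

SINGLE-HEIGHT CLASSIFICATION of the quadratic family (parts III–VIII, any differentiable `γ`, one height, `Q = Hess W ≠ 0`): `Q` indefinite
(`DG < E²`) or rank one transverse ⇒ `γ` affine on `ℝ`; `Q` definite or rank one aligned ⇒ `γ` affine on the value half-line.  In every case a
THICK structure function that is affine on no interval admits NO quadratic slice with `Q ≠ 0` at any height: on such a column the quadratic
family reduces to the affine slices of part I.  Honest scope: toy sub-family of R3 (`hGN` stays XL, not in print); kinematic (no NS); ansatz
substitution taken as hypothesis.  presearch: as parts III–VII. [folklore]
-/

noncomputable section

namespace Summit.NavierStokesRegularity.NavierStokesRegularity.Theorems.PoloidalWindowDoorPoloidalWindowRigidityZShockTurningShearAligned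

-- the summit and its single sub-problem share the name (CONVENTIONS §1)
set_option linter.dupNamespace false

open Set Filter Topology
open Summit.NavierStokesRegularity.NavierStokesRegularity.Theorems.PoloidalWindowDoorPoloidalWindowRigidityZShockTurningShearDefinite

/-! ## The planar kernel -/

/-- **Planar kernel.**  If `T ≠ 0` and `T·γ(m+τ) + 2T·τ·γ'(m+τ) = l + ρτ` for all `τ ≥ 0` (with `γ'` the derivative of `γ`), then
`γ(m+τ) = l/T + (ρ/(3T))τ` for `τ ≥ 0` and `γ'(m+τ) = ρ/(3T)` for `τ > 0`. [folklore] -/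
theorem planar_kernel {γ γ' : ℝ → ℝ} {m T l ρ : ℝ} (hT : T ≠ 0) (hγ : ∀ t, HasDerivAt γ (γ' t) t)
    (h : ∀ τ, 0 ≤ τ → T * γ (m + τ) + 2 * T * τ * γ' (m + τ) = l + ρ * τ) :
    (∀ τ, 0 ≤ τ → γ (m + τ) = l / T + ρ / (3 * T) * τ) ∧ (∀ τ, 0 < τ → γ' (m + τ) = ρ / (3 * T)) := by
  -- `δ(τ) = γ(m+τ) − l/T − (ρ/(3T))τ` satisfies `δ + 2τδ' = 0` on `[0, ∞)`
  have hδ' : ∀ τ, HasDerivAt (fun τ => γ (m + τ) - l / T - ρ / (3 * T) * τ) (γ' (m + τ) - ρ / (3 * T)) τ := by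
    intro τ
    have h1 : HasDerivAt (fun τ => γ (m + τ)) (γ' (m + τ)) τ := HasDerivAt.comp_const_add m τ (hγ (m + τ))
    have h2 := (h1.sub_const (l / T)).fun_sub (hasDerivAt_const_mul (ρ / (3 * T)) (x := τ))
    simpa using h2
  have hode : ∀ τ, 0 ≤ τ → (γ (m + τ) - l / T - ρ / (3 * T) * τ) +
      2 * τ * (γ' (m + τ) - ρ / (3 * T)) = 0 := by
    intro τ hτ
    have h1 := h τ hτ
    have h2 : T * ((γ (m + τ) - l / T - ρ / (3 * T) * τ) + 2 * τ * (γ' (m + τ) - ρ / (3 * T))) = 0 := by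
      have h3 : T * (l / T) = l := by field_simp
      have h4 : T * (ρ / (3 * T)) = ρ / 3 := by field_simp
      linear_combination h1 - h3 + (-τ - 2 * τ) * h4
    rcases mul_eq_zero.mp h2 with h5 | h5
    · exact absurd h5 hT
    · exact h5
  -- `F(τ) = τ δ(τ)²` has zero derivative on `(0,∞)` and vanishes at `0`
  have hF : ∀ τ, HasDerivAt (fun τ => τ * (γ (m + τ) - l / T - ρ / (3 * T) * τ) ^ 2)
      (1 * (γ (m + τ) - l / T - ρ / (3 * T) * τ) ^ 2 +
        τ * (2 * (γ (m + τ) - l / T - ρ / (3 * T) * τ) * (γ' (m + τ) - ρ / (3 * T)))) τ := by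
    intro τ
    have h1 := (hδ' τ).fun_pow 2
    have h2 := (hasDerivAt_id τ).fun_mul h1
    refine h2.congr_deriv ?_
    simp
  have hval : ∀ τ, 0 < τ → τ * (γ (m + τ) - l / T - ρ / (3 * T) * τ) ^ 2 = 0 := by
    intro τ hτ
    obtain ⟨ξ, hξ, hslope⟩ := exists_hasDerivAt_eq_slope
      (fun τ => τ * (γ (m + τ) - l / T - ρ / (3 * T) * τ) ^ 2) _ hτ
      (fun t _ => (hF t).continuousAt.continuousWithinAt) (fun t _ => hF t)
    have hzero : 1 * (γ (m + ξ) - l / T - ρ / (3 * T) * ξ) ^ 2 +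
        ξ * (2 * (γ (m + ξ) - l / T - ρ / (3 * T) * ξ) * (γ' (m + ξ) - ρ / (3 * T))) = 0 := by
      have h1 := hode ξ hξ.1.le
      linear_combination (γ (m + ξ) - l / T - ρ / (3 * T) * ξ) * h1
    rw [hzero] at hslope
    have h2 := (div_eq_zero_iff.mp hslope.symm)
    rcases h2 with h2 | h2
    · simpa using h2
    · exfalso; exact hτ.ne' (by simpa using h2)
  have part1 : ∀ τ, 0 ≤ τ → γ (m + τ) = l / T + ρ / (3 * T) * τ := by
    intro τ hτ
    rcases hτ.eq_or_lt with h0 | hpos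
    · rw [← h0]
      have h1 := h 0 le_rfl
      simp only [add_zero, mul_zero, zero_mul] at h1
      simp only [add_zero, mul_zero]
      rw [eq_div_iff hT]
      linear_combination h1
    · have h1 := hval τ hpos
      rcases mul_eq_zero.mp h1 with h2 | h2
      · exact absurd h2 hpos.ne'
      · have h3 := pow_eq_zero_iff two_ne_zero |>.mp h2
        linarith
  refine ⟨part1, fun τ hτ => ?_⟩
  have h1 := hode τ hτ.le
  have h2 : γ (m + τ) - l / T - ρ / (3 * T) * τ = 0 := by rw [part1 τ hτ.le]; ring
  rw [h2, zero_add] at h1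
  rcases mul_eq_zero.mp h1 with h3 | h3
  · exfalso; exact hτ.ne' (by linarith)
  · linarith

/-! ## Single height: aligned parabolic cylinder -/

/-- ★ **An aligned rank-one quadratic slice at ONE height makes the structure function affine on its value half-line.**  `γ`
differentiable with derivative `γ'`; `W(y) = A + By₀ + Cy₁ + ½(Dy₀² + 2Ey₀y₁ + Gy₁²)` with `D > 0`, `DG = E²`, `CD = BE`; `ℓ` any
quadratic polynomial with `ℓ = γ(W)(D+G) + γ'(W)|∇W|²` on `ℝ²`.  Then there are `m, γ₀, μ` with `W ≥ m`, `W = m ⇒ |∇W|² = 0`,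
`γ(m+τ) = γ₀ + 2μ(m+τ)` (`τ ≥ 0`), `γ'(m+τ) = 2μ` (`τ > 0`). [folklore] -/
theorem quadSlice_rank1Aligned_affine {γ γ' : ℝ → ℝ} (hγ : ∀ t, HasDerivAt γ (γ' t) t)
    {A B C D E G a b c d e g : ℝ} {W P ℓ : ℝ → ℝ → ℝ}
    (hW : ∀ y₀ y₁, W y₀ y₁ = A + B * y₀ + C * y₁ + (D * y₀ ^ 2 + 2 * E * y₀ * y₁ + G * y₁ ^ 2) / 2)
    (hP : ∀ y₀ y₁, P y₀ y₁ = (B + D * y₀ + E * y₁) ^ 2 + (C + E * y₀ + G * y₁) ^ 2)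
    (hℓ : ∀ y₀ y₁, ℓ y₀ y₁ = a + b * y₀ + c * y₁ + (d * y₀ ^ 2 + 2 * e * y₀ * y₁ + g * y₁ ^ 2) / 2)
    (hD : 0 < D) (hDG : D * G = E ^ 2) (hal : C * D = B * E)
    (hpde : ∀ y₀ y₁, ℓ y₀ y₁ = γ (W y₀ y₁) * (D + G) + γ' (W y₀ y₁) * P y₀ y₁) :
    ∃ m γ₀ μ : ℝ, (∀ y₀ y₁, m ≤ W y₀ y₁) ∧ (∀ y₀ y₁, W y₀ y₁ = m → P y₀ y₁ = 0) ∧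
      (∀ τ, 0 ≤ τ → γ (m + τ) = γ₀ + 2 * μ * (m + τ)) ∧ (∀ τ, 0 < τ → γ' (m + τ) = 2 * μ) := by
  have hDne : D ≠ 0 := hD.ne'
  have hTD : (D + G) * D = D ^ 2 + E ^ 2 := by linear_combination hDG
  have hT : 0 < D + G := by
    have h1 : 0 < D ^ 2 + E ^ 2 := by positivity
    nlinarith
  -- a bottom point `c = (−B/D, 0)`: `∇W(c) = 0`
  obtain ⟨c₀, c₁, hcen₀, hcen₁⟩ : ∃ c₀ c₁ : ℝ, B + D * c₀ + E * c₁ = 0 ∧ C + E * c₀ + G * c₁ = 0 := by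
    refine ⟨-B / D, 0, ?_, ?_⟩
    · field_simp; ring
    · field_simp; linear_combination hal
  set m := W c₀ c₁ with hm
  have hWray : ∀ t d₀ d₁ : ℝ, W (c₀ + t * d₀) (c₁ + t * d₁) =
      m + t ^ 2 * (D * d₀ ^ 2 + 2 * E * d₀ * d₁ + G * d₁ ^ 2) / 2 := by
    intro t d₀ d₁
    rw [hW, hm, hW]
    linear_combination (t * d₀) * hcen₀ + (t * d₁) * hcen₁
  have hPray : ∀ t d₀ d₁ : ℝ, P (c₀ + t * d₀) (c₁ + t * d₁) =
      t ^ 2 * ((D * d₀ + E * d₁) ^ 2 + (E * d₀ + G * d₁) ^ 2) := by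
    intro t d₀ d₁
    rw [hP]
    have h1 : B + D * (c₀ + t * d₀) + E * (c₁ + t * d₁) = t * (D * d₀ + E * d₁) := by linear_combination hcen₀
    have h2 : C + E * (c₀ + t * d₀) + G * (c₁ + t * d₁) = t * (E * d₀ + G * d₁) := by linear_combination hcen₁
    rw [h1, h2]; ring
  have hℓray : ∀ t d₀ d₁ : ℝ, ℓ (c₀ + t * d₀) (c₁ + t * d₁) + ℓ (c₀ + (-t) * d₀) (c₁ + (-t) * d₁) =
      2 * ℓ c₀ c₁ + t ^ 2 * (d * d₀ ^ 2 + 2 * e * d₀ * d₁ + g * d₁ ^ 2) := by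
    intro t d₀ d₁
    rw [hℓ, hℓ, hℓ]; ring
  have e0 : ∀ y₀ : ℝ, c₀ + 1 * (y₀ - c₀) = y₀ := fun _ => by ring
  have e1 : ∀ y₁ : ℝ, c₁ + 1 * (y₁ - c₁) = y₁ := fun _ => by ring
  -- `P = 2(D+G)(W − m)` identically and `W ≥ m`
  have hPeq : ∀ y₀ y₁, P y₀ y₁ = 2 * (D + G) * (W y₀ y₁ - m) := by
    intro y₀ y₁
    have hWy := hWray 1 (y₀ - c₀) (y₁ - c₁)
    have hPy := hPray 1 (y₀ - c₀) (y₁ - c₁)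
    rw [e0, e1] at hWy hPy
    rw [hWy, hPy]
    linear_combination (-((y₀ - c₀) ^ 2 + (y₁ - c₁) ^ 2)) * hDG
  have hPnn : ∀ y₀ y₁, 0 ≤ P y₀ y₁ := by
    intro y₀ y₁; rw [hP]; positivity
  have hlow : ∀ y₀ y₁, m ≤ W y₀ y₁ := by
    intro y₀ y₁
    nlinarith [hPeq y₀ y₁, hPnn y₀ y₁]
  have hbot : ∀ y₀ y₁, W y₀ y₁ = m → P y₀ y₁ = 0 := by
    intro y₀ y₁ h
    rw [hPeq, h, sub_self, mul_zero]
  -- the ray identity along `d = (1, 0)`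
  have ray₁ : ∀ τ, 0 ≤ τ → (D + G) * γ (m + τ) + 2 * (D + G) * τ * γ' (m + τ) = ℓ c₀ c₁ + (d / D) * τ := by
    intro τ hτ
    set t := Real.sqrt (2 * τ / D) with ht
    have ht2 : t ^ 2 = 2 * τ / D := by rw [ht, Real.sq_sqrt (div_nonneg (by linarith) hD.le)]
    have hnt2 : (-t) ^ 2 = 2 * τ / D := by rw [neg_sq, ht2]
    have hq : D * (1:ℝ) ^ 2 + 2 * E * 1 * 0 + G * 0 ^ 2 = D := by ring
    have hp : (D * (1:ℝ) + E * 0) ^ 2 + (E * 1 + G * 0) ^ 2 = D ^ 2 + E ^ 2 := by ring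
    have hr : d * (1:ℝ) ^ 2 + 2 * e * 1 * 0 + g * 0 ^ 2 = d := by ring
    have hWp : W (c₀ + t * 1) (c₁ + t * 0) = m + τ := by rw [hWray, hq, ht2]; field_simp
    have hWn : W (c₀ + (-t) * 1) (c₁ + (-t) * 0) = m + τ := by rw [hWray, hq, hnt2]; field_simp
    have hPp : P (c₀ + t * 1) (c₁ + t * 0) = 2 * τ / D * (D ^ 2 + E ^ 2) := by rw [hPray, hp, ht2]
    have hPn : P (c₀ + (-t) * 1) (c₁ + (-t) * 0) = 2 * τ / D * (D ^ 2 + E ^ 2) := by rw [hPray, hp, hnt2]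
    have h1 := hpde (c₀ + t * 1) (c₁ + t * 0)
    have h2 := hpde (c₀ + (-t) * 1) (c₁ + (-t) * 0)
    have h3 := hℓray t 1 0
    rw [hWp, hPp] at h1
    rw [hWn, hPn] at h2
    rw [hr, ht2] at h3
    have h4 : 2 * τ / D * (D ^ 2 + E ^ 2) = 2 * (D + G) * τ := by
      rw [← hTD]; field_simp
    rw [h4] at h1 h2
    linear_combination (h3 - h1 - h2) / 2
  obtain ⟨haff, hder⟩ := planar_kernel hT.ne' hγ ray₁
  refine ⟨m, ℓ c₀ c₁ / (D + G) - d / D / (3 * (D + G)) * m, d / D / (3 * (D + G)) / 2, hlow, hbot,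
    fun τ hτ => ?_, fun τ hτ => ?_⟩
  · rw [haff τ hτ]; ring
  · rw [hder τ hτ]; ring

end Summit.NavierStokesRegularity.NavierStokesRegularity.Theorems.PoloidalWindowDoorPoloidalWindowRigidityZShockTurningShearAligned

end
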